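import Literature.MathematicalPhysics.QuantumFieldTheory.Balaban1983to89.B8Eq1112Local
import Literature.MathematicalPhysics.QuantumFieldTheory.Balaban1983to89.B8Ineq1109Local

/-!
# `Balaban1983to89.B8Thm4UniqueLocal` — T. Bałaban, *Spaces of regular gauge field configurations on a lattice and gauge fixing
# conditions*, Commun. Math. Phys. **99** (1985) 75–102 [Balaban1985RegularSpaces] ("B8"), THEOREM 4 p. 88, THE UNIQUENESS CLAUSE
# («exactly one gauge transformation u»), proof p. 95: the paragraph «To prove the uniqueness … The uniqueness implies u′ = 1, or
# u₁ = u₂» ASSEMBLED ON THE CONCRETE `ℤᵈ` CARRIERS (tower-local hypotheses, general unitary background) from the tree's kernel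
# theorems for its three printed/tacit steps, MODULO Proposition 5's uniqueness clause (1.109) in concrete form

statement-level skeleton of published theorems with citation tags; proofs where landed; nothing here is a claim about the
Yang–Mills mass gap

PDF held: `paper:balaban1985-cmp99-regular-spaces-gauge-fixing` (journal page = PDF page + 74); p. 95 [PDF 21] read on the text layer by
this seat (2026-08-26), (1.107)–(1.109) p. 94 [PDF 20].

WHAT IS PRINTED (p. 95, verbatim): "To prove the uniqueness let us assume that there are two transformations `u₁, u₂` satisfying the
conditions of the Theorem 4. Then we have two configurations `U₁ = U′^{u₁⁻¹}`, `U₂ = U′^{u₂⁻¹}`, `U₁ = e^{iηA₁}`, `U₂ = e^{iηA₂}`. They satisfy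
all the conditions of the theorem, hence `A₂` satisfies (1.37), (1.38), and both configurations `A₁, A₂` satisfy the bounds (1.62). This
implies that `u′ = u₂u₁⁻¹` satisfies the regularity conditions (1.73), (1.74) with `k` instead of `k − 1` and with a worse constant. This
follows from Proposition 8 of [3]. We have `u′u₁ = u₂`, hence `\overline{R₀u′u₁}^j = 1` on `Λ_j`, `j = 0, 1, …, k`, `U₁^{u′⁻¹} = U₂`, (1.112) thus
`u′` is a solution of the problem described in Proposition 5. For `α₀ + α₁` sufficiently small the assumptions of this proposition are
satisfied and we have the uniqueness property. In the considered case a configuration identically equal to 1 is a solution also,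
because `U₁` satisfies the same conditions as `U₂`. The uniqueness implies `u′ = 1`, or `u₁ = u₂`."  Proposition 5 (p. 94), the clause
used: "there exists a configuration `u′ = e^{iλ}` satisfying the equations `RD*(1/(iη)) log U₁^{u′⁻¹} = 0`, `\overline{R₀u′u₁}^j = 1` on
`Λ_j`, `j = 0, 1, …, k` (1.107) … Such a configuration `u′` is unique in the domain `|λ|, |Dλ|₍₋₁₎ < c₃`. (1.109)".

WHY THIS FILE (the N05 KNIT seat's assembly, YM Track A node N05 = [B8]).  The abstract kernel form of this paragraph is
`B8.thm4Unique_of_prop5R` (over `GFData2` + `GaugeCalc`), which takes as hypothesis SHAPES (not re-proved there) the two unprinted / tacit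
steps the cell located: `hReg` = the level-`k` re-run of (1.70)–(1.74) for a level-`k` SOLUTION (census G-A23-1: Proposition 8 of [3]
presupposes `u₁, u₂ ∈ Λ_k(U₀, α₃)` individually) and `hP8` = «`λ′ = (1/i) log u′` lies in the domain (1.109)».  On the concrete `ℤᵈ`
carriers both are now KERNEL THEOREMS of the tree, by seat `pub-ymgap-dag-n04-b`: `B8Eq1112Local.eq1112_local_inv_mul` ((1.112) on the
tower, from local hypotheses — the re-run + Proposition 8 of [3]) and `B8Ineq1109Local.ineq1109_scaled` / `lam_of_unit` /
`mgauge_quotient_eq` (the tacit (1.109)-domain estimate via (1.84)).  THIS FILE composes them, by name, into the printed conclusion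
`u₁ = u₂` on `Bʲ(Λ_j)`, `j ≤ k`, the ONE remaining named hypothesis being Proposition 5's uniqueness clause (1.109) for the datum
`(U₀, U₁, u₁)` in concrete tower-local form (`hP5u` below; Sects. D–E at `k` levels — seat `pub-ymgap-dag-n05-b`'s programme
`B8Eq1117KLevel` / `B8DprimeKLevelLipschitz` / `B8Claim97KLevel`, and the Sect. D fixed point, not yet a tree theorem on these carriers),
with the Landau equation (1.38)/(1.107) an ABSTRACT predicate `Lan` of the configuration `U₁^{u′⁻¹}` (its operator `R(U₀)` of [4] (3.21) is
not yet an object of the tree on these carriers — interface I-B8-2 of the literature cell; `Lan` is read only through the two printed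
facts «`U₂ = U₁^{u′⁻¹}` satisfies it» and «`U₁ = U₁^{1⁻¹}` satisfies it»).

WHAT THIS FILE PROVES (kernel, 0 sorry, theorems only, no `def`; conventions of the n04-b files: moving-frame action `U₁^{u}` =
`B7Eq92Concrete.mgauge U₀ u U₁` ((55) of [3] = (1.17)), so print's `u′ = u₂u₁⁻¹` is `u′ = u₁⁻¹u₂` and print's `u′u₁` is `u₁u′`
(`B8Ineq1109Local.mgauge_quotient_eq`); `U_i = e^{iηA_i}` = `B8Eq184Proof.cfgExp η A_i`; tower `Bʲ(y) = [tlo L y j, thi L y j]` of `B8Ineq130`;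
`𝔸` a nontrivial C⋆-algebra = print's `G ⊂ U(N)`; `c` = print's `B′₁(α₀ + α₁)` of (1.62), `α₃ = 40d·c`, `α₃′ = 2α₃ + 2·1116·α₃²`).
* §1 device: the action laws used on p. 95 (`U′ = U₁^{u₁}` ⇒ `U₁ = U′^{u₁⁻¹}`; `U^{1} = U`; `U_iU₀ = (U′U₀)^{u_i⁻¹}` is as regular as `U′U₀` on
  every box — gauge invariance of (1.7), `B8Eq115GaugeFixing.pdevOn_gaugeAct`), `e^{iηA} = expCfg (iηA)` and the (1.62) ⇒ (1.69)-currency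
  conversion `η·c(Lʲη)⁻¹ = cL⁻ʲ`.
* §2 `quotient_sub_one_le_local` — «`u′ = u₂u₁⁻¹` satisfies (1.73) with `k` instead of `k − 1` and with a worse constant» READ AT THE FINE
  LEVEL: `‖u′(x) − 1‖ ≤ α₃′` for `x ∈ Bʲ(y)`, `y ∈ Λ_j` (= `eq1112_local_inv_mul` at `m = 0`, its hypotheses produced from the typed classes
  `InAx` (1.19)/(1.34) and `Restr129` (1.29) by `B8Eq131Derivation.ax119_iff_ax67`, `B8Eq178Averages.restr129_iff_uavg`).
* §3 `lam_in_domain_local` — «thus `u′` is a solution of the problem described in Proposition 5 … the assumptions of this proposition are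
  satisfied»: `λ′ := (1/i) log u′` has `e^{iλ′} = u′`, `‖λ′‖ ≤ 2α₃′` at the sites and `(Lʲη)‖(Dλ′)(b)‖ ≤ 5c` at the bonds of `Bʲ(y)`,
  `y ∈ Λ_j` (`lam_of_unit` + `ineq1109_scaled`, the identity `U₁^{u′⁻¹} = U₂` read bondwise through `e^{iλ′} = u′` at both ends).
* §4 **`thm4_unique_local`** — THE UNIQUENESS CLAUSE OF THEOREM 4 on `⋃_{j ≤ k} Bʲ(Λ_j)`: two gauge transformations `u₁, u₂` with (1.29),
  each bringing `U′` from its Landau-gauged small field `U_i = e^{iηA_i}` ((1.38) = `Lan`, (1.62) on the towers), coincide on every `Bʲ(y)`,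
  `y ∈ Λ_j`, `j ≤ k` — GIVEN Proposition 5's uniqueness clause (1.109) for `(U₀, U₁, u₁)` (`hP5u`: two configurations `v = e^{iλ}`,
  `w = e^{iμ}` on the towers with `λ, μ` `𝔤`-valued (self-adjoint) in the domain «`|λ| < c_u`, `(Lʲη)|Dλ| < c_u` on `Bʲ(Λ_j)`», both
  solving (1.107) — `Lan (U₁^{v⁻¹})` and (1.29) for `u₁v` — agree on the towers), applied to `u′` and `1` exactly as printed.

READINGS / DECLARED DEVIATIONS.  (i) TOWER-LOCAL currency throughout (hypotheses (1.33) for `U₀`, (1.34) for `U′U₀`, (1.62) for `A_i` and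
the domain (1.109) are read on the towers `Bʲ(y)`, `y ∈ Λ_j`, `j ≤ k`, bonds with both ends in the tower — the currency of
`B8Eq1112Local` / `B8Eq106Local` / `B8Eq1117KLevel`; print: «on Ω_j»; `⋃_j Bʲ(Λ_j) = Ω₀` for an admissible sequence, a fact not used here).
(ii) The conclusion `u₁ = u₂` is asserted ON THE TOWERS only: a gauge transformation typed as `Site d → 𝔸ˣ` is unconstrained off `Ω₀` by
every hypothesis of Theorem 4, so literal equality on `ℤᵈ` is not a consequence (typing note for the future B8 family of record: its `GT`
must be carried by `Ω₀`).  (iii) Explicit sufficient smallness (`α₃ = 40d·c ≤ 1/5000`, `B7Eq167General`'s list, `2α₃′ < c_u`, `5c < c_u`)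
for print's «for α₀ + α₁ sufficiently small»; `≤` for `<` in (1.62).  (iv) (1.37) is not used by the uniqueness paragraph beyond feeding
Proposition 3 (which supplies (1.69) for `U₁` — a hypothesis OF Proposition 5, hence inside `hP5u` here) and is not assumed.
(v) `Lan` abstract (see WHY).  NOT CLAIMED: Proposition 5 (either half), Proposition 3, the existence clause of Theorem 4, the value of
`c₃`; nothing of the node N05 is discharged by this file.  Unit `pub-ymgap-dag-n05-a` (g3), 2026-08-26.  Tree API by name only, nothing
restated.
-/

noncomputable section

open NormedSpace

namespace Literature.MathematicalPhysics.QuantumFieldTheory.Balaban1983to89.B8Thm4UniqueLocal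

open Complex (I I_ne_zero)
open MatrixLog B7Prop1Explicit B7Prop2Explicit B7Prop3Flat B7Prop1Local B7Eq92Concrete B7Eq99Concrete B7Eq84Concrete
open B8Ineq130 (tlo thi)
open B8Ineq132 (Under covDerivFwd)
open B8Eq119TwistedAxial (InAx Restr129)
open B8Eq131Derivation (ax119_iff_ax67)
open B8Eq178Averages (restr129_iff_uavg)
open B8Eq106Local (under_iff_tower)
open B8Eq184Proof (gaugeExp cfgExp)
open B8Eq1112Local (eq1112_local_inv_mul)
open B8Ineq1109Local (ineq1109_scaled lam_of_unit mgauge_quotient_eq)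

-- `Site` alone could resolve to the torus sites of `Setup.lean`; re-export the `ℤ^d` sites of `B7Prop1Explicit`.
export B7Prop1Explicit (Site)

variable {d : ℕ}

/-! ## §1 Device: action laws, the exponential dictionary, box membership -/

section Device

variable {G : Type*} [Group G]

/-- `U^{1} = U` for the moving-frame action (55) of [3] (= (1.17)). [cite: Balaban1985Averaging, (55) p.27] -/
private theorem mgauge_one_gt (V₀ W : Site d → Fin d → G) : mgauge V₀ 1 W = W := by
  funext x κ
  simp [mgauge_apply]

/-- `U′ = U₁^{u}` ⇒ `U₁ = U′^{u⁻¹}` ((55) is an action, `B7Eq106Concrete.mgauge_mgauge`). [cite: Balaban1985Averaging, (55) p.27] -/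
private theorem mgauge_inv_of_eq (V₀ : Site d → Fin d → G) (u : Site d → G) (W U' : Site d → Fin d → G)
    (h : mgauge V₀ u W = U') : mgauge V₀ u⁻¹ U' = W := by
  rw [← h, B7Eq106Concrete.mgauge_mgauge, inv_mul_cancel, mgauge_one_gt]

end Device

section Dictionary

variable {𝔸 : Type*} [NormedRing 𝔸] [NormedAlgebra ℂ 𝔸] [CompleteSpace 𝔸]

/-- `e^{iηA} = expCfg (iηA)`: the n04-b exponent `B = iηA` of `B8Eq1112Local` and the `cfgExp η A` of `B8Eq184Proof` name the same
configuration. [cite: Balaban1985RegularSpaces, (1.69) p.88] -/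
private theorem expCfg_smul_eq_cfgExp (η : ℝ) (A : Site d → Fin d → 𝔸) :
    expCfg (fun x κ => (I : ℂ) • (η • A x κ)) = cfgExp η A := rfl

omit [CompleteSpace 𝔸] in
/-- `‖iηA_b‖ = η‖A_b‖`, so (1.62) `‖A_b‖ ≤ c(Lʲη)⁻¹` reads `‖iηA_b‖ ≤ cL⁻ʲ` (`η > 0`). [cite: Balaban1985RegularSpaces, (1.62) p.87, (1.69) p.88] -/
private theorem norm_smul_le_of_62 {η : ℝ} (hη : 0 < η) {L : ℕ} (hL1 : 1 ≤ L) (j : ℕ) {c : ℝ} {a : 𝔸}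
    (ha : ‖a‖ ≤ c * ((L : ℝ) ^ j * η)⁻¹) : ‖(I : ℂ) • (η • a)‖ ≤ c * ((L : ℝ) ^ j)⁻¹ := by
  have hLr : (1 : ℝ) ≤ L := by exact_mod_cast hL1
  have hLj : (0 : ℝ) < (L : ℝ) ^ j := by positivity
  rw [norm_smul, Complex.norm_I, one_mul, norm_smul, Real.norm_eq_abs, abs_of_pos hη]
  calc η * ‖a‖ ≤ η * (c * ((L : ℝ) ^ j * η)⁻¹) := mul_le_mul_of_nonneg_left ha hη.le
    _ = c * ((L : ℝ) ^ j)⁻¹ := by field_simp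

end Dictionary

omit d in
/-- `x ∈ Bʲ(y)` in the two spellings: `InBox (tlo L y j) (thi L y j) x` ⟺ `tlo L y j ≤ x ≤ thi L y j`. [folklore] -/
private theorem inBox_iff_le {d : ℕ} (L j : ℕ) (y x : Site d) :
    InBox (tlo L y j) (thi L y j) x ↔ tlo L y j ≤ x ∧ x ≤ thi L y j :=
  ⟨fun h => ⟨fun i => (h i).1, fun i => (h i).2⟩, fun h i => ⟨h.1 i, h.2 i⟩⟩

/-- `x ∈ Bʲ(y)`: `InBox` ⟺ `B8Ineq132.Under` (`B8Eq106Local.under_iff_tower`). [folklore] -/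
private theorem inBox_iff_under (L j : ℕ) (y x : Site d) : InBox (tlo L y j) (thi L y j) x ↔ Under L j y x := by
  rw [inBox_iff_le, under_iff_tower]

/-! ## §2 «u′ = u₂u₁⁻¹ satisfies (1.73) with k instead of k − 1 and with a worse constant», read at the fine level -/

section Main

variable {𝔸 : Type*} [CStarAlgebra 𝔸] [Nontrivial 𝔸]
variable {L k : ℕ} {η : ℝ} {Λ : ℕ → Set (Site d)} {U₀ U' : Site d → Fin d → 𝔸ˣ} {α₀ αP c : ℝ}
  {u₁ u₂ : Site d → 𝔸ˣ} {A₁ A₂ : Site d → Fin d → 𝔸}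

/-- **(1.112) AT THE FINE LEVEL for two solutions, from the typed classes.**  Let `U₀`, `U′`, `u₁`, `u₂` be unitary-valued, `U′U₀` in the
block axial gauge `Ax_k(𝔅_k, U₀)` ((1.34), `InAx`), `u_i` with (1.29) (`Restr129`), `U′ = U_i^{u_i}` with `U_i = e^{iηA_i}` and (1.62)
`‖A_i‖ ≤ c(Lʲη)⁻¹` on the tower `Bʲ(y)` under `y ∈ Λ_j` (`j ≤ k`), `U₀` resp. `U′U₀` regular on `Bʲ(y)` ((1.33), (1.34)), with the `j`-free
smallness of `B8Eq1112Local`.  Then `u′ = u₁⁻¹u₂` (print: `u₂u₁⁻¹`) satisfies `‖u′(x) − 1‖ ≤ α₃′ = 2α₃ + 2·1116·α₃²`, `α₃ = 40d·c`, at every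
`x ∈ Bʲ(y)` — (1.73) «with k instead of k − 1 and with a worse constant» at the level `m = 0` of `B8Eq1112Local.eq1112_local_inv_mul`
(whose (1.19)/(1.29) inputs are the typed classes through `ax119_iff_ax67`, `restr129_iff_uavg`, and whose regularity input for `U_iU₀ =
(U′U₀)^{u_i⁻¹}` is that of `U′U₀` by gauge invariance, `pdevOn_gaugeAct`). [cite: Balaban1985RegularSpaces, (1.112) p.95, (1.73) p.88; Balaban1985Averaging, Proposition 8 p.45] -/
theorem quotient_sub_one_le_local (hd : 1 ≤ d) (hL : 2 ≤ L) (hL1 : 1 ≤ L) (hη : 0 < η)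
    (hU₀ : ∀ x κ, U₀ x κ ∈ unitaryUnits 𝔸) (hU' : ∀ x κ, U' x κ ∈ unitaryUnits 𝔸)
    (hu₁ : ∀ x, u₁ x ∈ unitaryUnits 𝔸) (hu₂ : ∀ x, u₂ x ∈ unitaryUnits 𝔸)
    (hα : 0 < α₀) (hα3 : C0 d * α₀ ≤ 1 / 3) (hα4 : 4 * α₀ ≤ c2' d L) (hc : 0 ≤ c)
    (hsmall : Real.exp (4 * (800 * ((d : ℝ) + 1) ^ 2 * ((d : ℝ) + 4)) * α₀) * (1 + 8 * (131072 * ((d : ℝ) + 1) ^ 2) * c) ≤ 2)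
    (hc₃ : 2 * c ≤ c3 d L) (hsm : 2048 * (d : ℝ) * c ≤ 1) (hα₃ : 40 * d * c ≤ 1 / 3000)
    (hαP : 0 < αP) (hαP3 : C0 d * αP ≤ 1 / 3) (hαP2 : 2 * αP ≤ c2' d L)
    (hAx : InAx L k Λ U₀ (U' * U₀)) (h129₁ : Restr129 L k Λ U₀ u₁) (h129₂ : Restr129 L k Λ U₀ u₂)
    (h₁ : mgauge U₀ u₁ (cfgExp η A₁) = U') (h₂ : mgauge U₀ u₂ (cfgExp η A₂) = U')
    {j : ℕ} (hjk : j ≤ k) {y : Site d} (hy : y ∈ Λ j)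
    (h33 : pdevOn (tlo L y j) (thi L y j) U₀ < α₀ * (((L : ℝ) ^ j)⁻¹) ^ 2)
    (h34 : pdevOn (tlo L y j) (thi L y j) (U' * U₀) < αP * (((L : ℝ) ^ j)⁻¹) ^ 2)
    (h62₁ : ∀ (x : Site d) (κ : Fin d), InBox (tlo L y j) (thi L y j) x → InBox (tlo L y j) (thi L y j) (x + e κ) →
      ‖A₁ x κ‖ ≤ c * ((L : ℝ) ^ j * η)⁻¹)
    (h62₂ : ∀ (x : Site d) (κ : Fin d), InBox (tlo L y j) (thi L y j) x → InBox (tlo L y j) (thi L y j) (x + e κ) →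
      ‖A₂ x κ‖ ≤ c * ((L : ℝ) ^ j * η)⁻¹)
    (x : Site d) (hx : InBox (tlo L y j) (thi L y j) x) :
    ‖(((u₁⁻¹ * u₂) x : 𝔸ˣ) : 𝔸) - 1‖ ≤ 2 * (40 * d * c) + 2 * 1116 * (40 * d * c) ^ 2 := by
  -- the two small fields as `expCfg B_i`, `B_i = iηA_i`
  set B₁ : Site d → Fin d → 𝔸 := fun x κ => (I : ℂ) • (η • A₁ x κ) with hB₁
  set B₂ : Site d → Fin d → 𝔸 := fun x κ => (I : ℂ) • (η • A₂ x κ) with hB₂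
  have hE₁ : expCfg B₁ = cfgExp η A₁ := expCfg_smul_eq_cfgExp η A₁
  have hE₂ : expCfg B₂ = cfgExp η A₂ := expCfg_smul_eq_cfgExp η A₂
  have hG : AvgClosed d L (unitaryUnits 𝔸) := avgClosed_unitaryUnits d L
  -- `U_i = U′^{u_i⁻¹}` is unitary-valued
  have hU₁ : mgauge U₀ u₁⁻¹ U' = expCfg B₁ := by rw [hE₁]; exact mgauge_inv_of_eq U₀ u₁ _ U' h₁
  have hU₂ : mgauge U₀ u₂⁻¹ U' = expCfg B₂ := by rw [hE₂]; exact mgauge_inv_of_eq U₀ u₂ _ U' h₂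
  have hunit : ∀ {u : Site d → 𝔸ˣ}, (∀ x, u x ∈ unitaryUnits 𝔸) → ∀ (x : Site d) (κ : Fin d),
      mgauge U₀ u⁻¹ U' x κ ∈ unitaryUnits 𝔸 := by
    intro u hu x κ
    rw [mgauge_apply, Pi.inv_apply]
    refine (unitaryUnits 𝔸).mul_mem ((unitaryUnits 𝔸).mul_mem ((unitaryUnits 𝔸).inv_mem (hu x)) (hU' x κ)) ?_
    refine (unitaryUnits 𝔸).inv_mem ?_
    rw [Rc_apply, Pi.inv_apply]
    exact (unitaryUnits 𝔸).mul_mem ((unitaryUnits 𝔸).mul_mem (hU₀ x κ) ((unitaryUnits 𝔸).inv_mem (hu _)))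
      ((unitaryUnits 𝔸).inv_mem (hU₀ x κ))
  have hBu₁ : ∀ (x : Site d) (κ : Fin d), expCfg B₁ x κ ∈ unitaryUnits 𝔸 := fun x κ => by rw [← hU₁]; exact hunit hu₁ x κ
  have hBu₂ : ∀ (x : Site d) (κ : Fin d), expCfg B₂ x κ ∈ unitaryUnits 𝔸 := fun x κ => by rw [← hU₂]; exact hunit hu₂ x κ
  -- (1.62) ⇒ the (1.69)-currency bound on `B_i`
  have h69₁ : ∀ (x : Site d) (κ : Fin d), InBox (tlo L y j) (thi L y j) x → InBox (tlo L y j) (thi L y j) (x + e κ) →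
      ‖B₁ x κ‖ ≤ c * ((L : ℝ) ^ j)⁻¹ := fun x κ hx hxe => norm_smul_le_of_62 hη hL1 j (h62₁ x κ hx hxe)
  have h69₂ : ∀ (x : Site d) (κ : Fin d), InBox (tlo L y j) (thi L y j) x → InBox (tlo L y j) (thi L y j) (x + e κ) →
      ‖B₂ x κ‖ ≤ c * ((L : ℝ) ^ j)⁻¹ := fun x κ hx hxe => norm_smul_le_of_62 hη hL1 j (h62₂ x κ hx hxe)
  -- `U_iU₀ = (U′U₀)^{u_i⁻¹}` is as regular as `U′U₀` on the tower (gauge invariance of (1.7))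
  have hP : ∀ {u : Site d → 𝔸ˣ} {Bi : Site d → Fin d → 𝔸}, (∀ x, u x ∈ unitaryUnits 𝔸) → mgauge U₀ u⁻¹ U' = expCfg Bi →
      pdevOn (tlo L y j) (thi L y j) (expCfg Bi * U₀) < αP * (((L : ℝ) ^ j)⁻¹) ^ 2 := by
    intro u Bi hu hUi
    have hu' : ∀ x, u⁻¹ x ∈ U1 𝔸 := fun x => by rw [Pi.inv_apply]; exact hG.le_U1 ((unitaryUnits 𝔸).inv_mem (hu x))
    rw [← hUi, mgauge_mul, B8Eq115GaugeFixing.pdevOn_gaugeAct hu']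
    exact h34
  have hP₁ := hP hu₁ hU₁
  have hP₂ := hP hu₂ hU₂
  -- the block axial gauge (1.19) of `U′ = U_i^{u_i}` on the tower, and (1.29) at `y`
  have hax : ∀ {u : Site d → 𝔸ˣ} {Bi : Site d → Fin d → 𝔸}, mgauge U₀ u⁻¹ U' = expCfg Bi →
      ∀ n, n < j → ∀ z : Site d, Under L (j - (n + 1)) y z → ∀ r : Fin d → Fin L,
        tHol (avgIter L U₀ n) (tildIter L U₀ (mgauge U₀ u (expCfg Bi)) n) ((L : ℤ) • z) (treeWord (boxVec L r)) = 1 := by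
    intro u Bi hUi n hn z hz r
    have hback : mgauge U₀ u (expCfg Bi) = U' := by
      rw [← hUi, B7Eq106Concrete.mgauge_mgauge, mul_inv_cancel, mgauge_one_gt]
    rw [hback]
    exact (ax119_iff_ax67 L U₀ U' n z r).1 (hAx j (by omega) hjk y hy n hn z hz r)
  have h129₁' : uavg L U₀ u₁ j y = 1 := (restr129_iff_uavg L k Λ U₀ u₁).1 h129₁ j hjk y hy
  have h129₂' : uavg L U₀ u₂ j y = 1 := (restr129_iff_uavg L k Λ U₀ u₂).1 h129₂ j hjk y hy
  obtain ⟨h173, -⟩ := eq1112_local_inv_mul hd hL hU₀ hα hα3 hα4 h33 hc hsmall hc₃ hsm hα₃ hαP hαP3 hαP2 hL1 hBu₁ hBu₂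
    h69₁ h69₂ hP₁ hP₂ (hax hU₁) (hax hU₂) h129₁' h129₂'
  obtain ⟨hx1, hx2⟩ := (inBox_iff_le L j y x).1 hx
  have h := h173 0 j (by omega) x hx1 hx2
  rwa [uavg_zero] at h

/-! ## §3 «thus u′ is a solution of the problem described in Proposition 5»: `λ′ = (1/i) log u′` lies in the domain (1.109) -/

/-- **`λ′ := (1/i) log u′` ON THE TOWERS** (the tacit step of p. 95): under the data of `quotient_sub_one_le_local` with `α₃ ≤ 1/5000`, the site
function `λ′(x) = i⁻¹ log(u₁⁻¹u₂)(x)` satisfies, on every tower `Bʲ(y)`, `y ∈ Λ_j`, `j ≤ k`: `e^{iλ′(x)} = u′(x)`, `λ′(x)` is self-adjoint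
(`𝔤`-valued: `u′(x)` is unitary, `B7Prop2Explicit.star_mlog_eq_neg`), `‖λ′(x)‖ ≤ 2α₃′`, and at every bond `b` of the tower
`(Lʲη)‖(Dλ′)(b)‖ ≤ 5c` — i.e. `λ′` lies in the domain (1.109) as soon as `2α₃′, 5c < c₃` (`B8Ineq1109Local.lam_of_unit`, `ineq1109_scaled`
with `U₁^{u′⁻¹} = U₂` from `mgauge_quotient_eq` read at the bond through `e^{iλ′} = u′` at both ends). [cite: Balaban1985RegularSpaces, p.95 (after (1.112)), (1.109) p.94, (1.84) p.90, (1.62) p.87] -/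
theorem lam_in_domain_local (hd : 1 ≤ d) (hL : 2 ≤ L) (hL1 : 1 ≤ L) (hη : 0 < η)
    (hU₀ : ∀ x κ, U₀ x κ ∈ unitaryUnits 𝔸) (hU' : ∀ x κ, U' x κ ∈ unitaryUnits 𝔸)
    (hu₁ : ∀ x, u₁ x ∈ unitaryUnits 𝔸) (hu₂ : ∀ x, u₂ x ∈ unitaryUnits 𝔸)
    (hα : 0 < α₀) (hα3 : C0 d * α₀ ≤ 1 / 3) (hα4 : 4 * α₀ ≤ c2' d L) (hc : 0 ≤ c)
    (hsmall : Real.exp (4 * (800 * ((d : ℝ) + 1) ^ 2 * ((d : ℝ) + 4)) * α₀) * (1 + 8 * (131072 * ((d : ℝ) + 1) ^ 2) * c) ≤ 2)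
    (hc₃ : 2 * c ≤ c3 d L) (hsm : 2048 * (d : ℝ) * c ≤ 1) (hα₃ : 40 * d * c ≤ 1 / 5000)
    (hαP : 0 < αP) (hαP3 : C0 d * αP ≤ 1 / 3) (hαP2 : 2 * αP ≤ c2' d L)
    (hAx : InAx L k Λ U₀ (U' * U₀)) (h129₁ : Restr129 L k Λ U₀ u₁) (h129₂ : Restr129 L k Λ U₀ u₂)
    (h₁ : mgauge U₀ u₁ (cfgExp η A₁) = U') (h₂ : mgauge U₀ u₂ (cfgExp η A₂) = U')
    {j : ℕ} (hjk : j ≤ k) {y : Site d} (hy : y ∈ Λ j)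
    (h33 : pdevOn (tlo L y j) (thi L y j) U₀ < α₀ * (((L : ℝ) ^ j)⁻¹) ^ 2)
    (h34 : pdevOn (tlo L y j) (thi L y j) (U' * U₀) < αP * (((L : ℝ) ^ j)⁻¹) ^ 2)
    (h62₁ : ∀ (x : Site d) (κ : Fin d), InBox (tlo L y j) (thi L y j) x → InBox (tlo L y j) (thi L y j) (x + e κ) →
      ‖A₁ x κ‖ ≤ c * ((L : ℝ) ^ j * η)⁻¹)
    (h62₂ : ∀ (x : Site d) (κ : Fin d), InBox (tlo L y j) (thi L y j) x → InBox (tlo L y j) (thi L y j) (x + e κ) →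
      ‖A₂ x κ‖ ≤ c * ((L : ℝ) ^ j * η)⁻¹)
    (x : Site d) (hx : InBox (tlo L y j) (thi L y j) x) :
    ((gaugeExp (fun z => (I⁻¹ : ℂ) • mlog ((((u₁⁻¹ * u₂) z : 𝔸ˣ)) : 𝔸)) x : 𝔸ˣ) : 𝔸) = (((u₁⁻¹ * u₂) x : 𝔸ˣ) : 𝔸) ∧
      IsSelfAdjoint ((I⁻¹ : ℂ) • mlog ((((u₁⁻¹ * u₂) x : 𝔸ˣ)) : 𝔸)) ∧
      ‖(I⁻¹ : ℂ) • mlog ((((u₁⁻¹ * u₂) x : 𝔸ˣ)) : 𝔸)‖ ≤ 2 * (2 * (40 * d * c) + 2 * 1116 * (40 * d * c) ^ 2) ∧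
      ∀ κ : Fin d, InBox (tlo L y j) (thi L y j) (x + e κ) →
        ((L : ℝ) ^ j * η) * ‖covDerivFwd η U₀ κ (fun z => (I⁻¹ : ℂ) • mlog ((((u₁⁻¹ * u₂) z : 𝔸ˣ)) : 𝔸)) x‖ ≤ 5 * c := by
  have hd' : (1 : ℝ) ≤ d := by exact_mod_cast hd
  have hα₃' : 40 * d * c ≤ 1 / 3000 := hα₃.trans (by norm_num)
  set a₃ : ℝ := 2 * (40 * d * c) + 2 * 1116 * (40 * d * c) ^ 2 with ha₃
  have ha₃0 : 0 ≤ 40 * d * c := by positivity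
  have ha₃le : a₃ ≤ 1 / 2000 := by rw [ha₃]; nlinarith
  set lam : Site d → 𝔸 := fun z => (I⁻¹ : ℂ) • mlog ((((u₁⁻¹ * u₂) z : 𝔸ˣ)) : 𝔸) with hlam
  -- (1.73) at the fine level on the tower, at every tower site
  have h173 : ∀ z : Site d, InBox (tlo L y j) (thi L y j) z → ‖(((u₁⁻¹ * u₂) z : 𝔸ˣ) : 𝔸) - 1‖ ≤ a₃ := fun z hz =>
    quotient_sub_one_le_local hd hL hL1 hη hU₀ hU' hu₁ hu₂ hα hα3 hα4 hc hsmall hc₃ hsm hα₃' hαP hαP3 hαP2 hAx h129₁ h129₂ h₁ h₂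
      hjk hy h33 h34 h62₁ h62₂ z hz
  -- `e^{iλ′} = u′` and `‖λ′‖ ≤ 2‖u′ − 1‖` at every tower site
  have hlog : ∀ z : Site d, InBox (tlo L y j) (thi L y j) z →
      ((gaugeExp lam z : 𝔸ˣ) : 𝔸) = (((u₁⁻¹ * u₂) z : 𝔸ˣ) : 𝔸) ∧ ‖lam z‖ ≤ 2 * a₃ := by
    intro z hz
    have hz' : ‖(((u₁⁻¹ * u₂) z : 𝔸ˣ) : 𝔸) - 1‖ ≤ 1 / 2 := (h173 z hz).trans (ha₃le.trans (by norm_num))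
    obtain ⟨he, hn⟩ := lam_of_unit ((u₁⁻¹ * u₂) z) hz'
    refine ⟨?_, hn.trans (by linarith [h173 z hz])⟩
    rw [gaugeExp]
    exact he
  -- `λ′` is `𝔤`-valued: `((1/i) log u′)⋆ = (1/i) log u′` for the unitary `u′ = u₁⁻¹u₂` near `1` (`B7Prop2Explicit.star_mlog_eq_neg`)
  have hsa : IsSelfAdjoint (lam x) := by
    have hux : (((u₁⁻¹ * u₂) x : 𝔸ˣ) : 𝔸) ∈ unitary 𝔸 :=
      mem_unitaryUnits.1 ((unitaryUnits 𝔸).mul_mem ((unitaryUnits 𝔸).inv_mem (hu₁ x)) (hu₂ x))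
    have h4 : ‖(((u₁⁻¹ * u₂) x : 𝔸ˣ) : 𝔸) - 1‖ ≤ 1 / 4 := (h173 x hx).trans (ha₃le.trans (by norm_num))
    show star (lam x) = lam x
    rw [hlam]
    simp only
    rw [star_smul, star_mlog_eq_neg hux h4, Complex.inv_I, Complex.star_def, map_neg, Complex.conj_I, neg_neg, smul_neg,
      neg_smul]
  obtain ⟨hex, hnx⟩ := hlog x hx
  refine ⟨hex, hsa, hnx, fun κ hxe => ?_⟩
  obtain ⟨hexe, hnxe⟩ := hlog (x + e κ) hxe
  -- `U₁^{u′⁻¹} = U₂` ((1.112)), read at the bond through `e^{iλ′} = u′` at both ends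
  have hq : mgauge U₀ (u₁⁻¹ * u₂)⁻¹ (cfgExp η A₁) = cfgExp η A₂ := mgauge_quotient_eq U₀ u₁ u₂ _ _ U' h₁ h₂
  have hux : gaugeExp lam x = (u₁⁻¹ * u₂) x := Units.ext hex
  have huxe : gaugeExp lam (x + e κ) = (u₁⁻¹ * u₂) (x + e κ) := Units.ext hexe
  have hU₁₂ : mgauge U₀ (fun z => (gaugeExp lam z)⁻¹) (cfgExp η A₁) x κ = cfgExp η A₂ x κ := by
    rw [← hq, mgauge_apply, mgauge_apply, hux, huxe, Pi.inv_apply, Pi.inv_apply]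
  have hG : AvgClosed d L (unitaryUnits 𝔸) := avgClosed_unitaryUnits d L
  have hUx : U₀ x κ ∈ U1 𝔸 := hG.le_U1 (hU₀ x κ)
  have hs : 2 * a₃ ≤ 1 / 1000 := by linarith
  have hc170 : c * ((L : ℝ) ^ j)⁻¹ ≤ 1 / 170 := by
    have hLr : (1 : ℝ) ≤ L := by exact_mod_cast hL1
    have hLj : (1 : ℝ) ≤ (L : ℝ) ^ j := one_le_pow₀ hLr
    have hinv : ((L : ℝ) ^ j)⁻¹ ≤ 1 := inv_le_one_of_one_le₀ hLj
    have hc' : c ≤ 1 / 170 := by nlinarith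
    calc c * ((L : ℝ) ^ j)⁻¹ ≤ c * 1 := mul_le_mul_of_nonneg_left hinv hc
      _ ≤ 1 / 170 := by linarith
  exact ineq1109_scaled hη U₀ A₁ A₂ κ hUx hL1 hs hnx hnxe (h62₁ x κ hx hxe) (h62₂ x κ hx hxe) hc170 hU₁₂

/-! ## §4 The uniqueness clause of Theorem 4, modulo Proposition 5's uniqueness clause (1.109) -/

/-- **THEOREM 4, UNIQUENESS CLAUSE (p. 88 «exactly one gauge transformation u»; proof p. 95), ON THE CONCRETE `ℤᵈ` CARRIERS, MODULO
PROPOSITION 5 (1.109).**  Data: `U₀` unitary-valued with (1.33) on the towers `Bʲ(y)`, `y ∈ Λ_j`, `j ≤ k`; `U′` unitary-valued with `U′U₀`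
regular on the towers and in the block axial gauge `Ax_k(𝔅_k, U₀)` ((1.34)); two unitary-valued gauge transformations `u₁, u₂` with (1.29)
(`Restr129`) such that `U_i := U′^{u_i⁻¹} = e^{iηA_i}` satisfies (1.62) `‖A_i‖ ≤ c(Lʲη)⁻¹` on the towers and the Landau equation (1.38)
(`Lan U_i`, abstract); smallness `α₃ = 40d·c ≤ 1/5000` + `B8Eq1112Local`'s list («for α₀ + α₁ sufficiently small»).  HYPOTHESIS `hP5u` =
Proposition 5's uniqueness clause for the datum `(U₀, U₁, u₁)` in concrete tower-local form: two configurations `v, w` which on the towers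
are `e^{iλ}`, `e^{iμ}` with `λ, μ` self-adjoint (`𝔤`-valued) in the domain «`‖λ‖ < c_u`, `(Lʲη)‖Dλ‖ < c_u` on `Bʲ(Λ_j)`» and which both
solve (1.107) — `Lan (U₁^{v⁻¹})` and (1.29) for `u₁v` — agree on the towers; thresholds `2α₃′ < c_u`, `5c < c_u`.  CONCLUSION: `u₁ = u₂` on every `Bʲ(y)`, `y ∈ Λ_j`, `j ≤ k`.
PROOF = the printed paragraph: `u′ = u₁⁻¹u₂` is `e^{iλ′}` on the towers with `λ′` in the domain (§3); it solves (1.107) (`U₁^{u′⁻¹} = U₂` is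
Landau, `u₁u′ = u₂` has (1.29)); «a configuration identically equal to 1 is a solution also, because U₁ satisfies the same conditions as
U₂»; `hP5u` gives `u′ = 1`, i.e. `u₁ = u₂`, on the towers. [cite: Balaban1985RegularSpaces, Thm 4 p.88, proof p.95 (1.112), Prop. 5 (1.107)–(1.109) p.94] -/
theorem thm4_unique_local (hd : 1 ≤ d) (hL : 2 ≤ L) (hL1 : 1 ≤ L) (hη : 0 < η)
    (hU₀ : ∀ x κ, U₀ x κ ∈ unitaryUnits 𝔸) (hU' : ∀ x κ, U' x κ ∈ unitaryUnits 𝔸)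
    (hu₁ : ∀ x, u₁ x ∈ unitaryUnits 𝔸) (hu₂ : ∀ x, u₂ x ∈ unitaryUnits 𝔸)
    (hα : 0 < α₀) (hα3 : C0 d * α₀ ≤ 1 / 3) (hα4 : 4 * α₀ ≤ c2' d L) (hc : 0 ≤ c)
    (hsmall : Real.exp (4 * (800 * ((d : ℝ) + 1) ^ 2 * ((d : ℝ) + 4)) * α₀) * (1 + 8 * (131072 * ((d : ℝ) + 1) ^ 2) * c) ≤ 2)
    (hc₃ : 2 * c ≤ c3 d L) (hsm : 2048 * (d : ℝ) * c ≤ 1) (hα₃ : 40 * d * c ≤ 1 / 5000)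
    (hαP : 0 < αP) (hαP3 : C0 d * αP ≤ 1 / 3) (hαP2 : 2 * αP ≤ c2' d L)
    {cu : ℝ} (hcu₁ : 2 * (2 * (40 * d * c) + 2 * 1116 * (40 * d * c) ^ 2) < cu) (hcu₂ : 5 * c < cu)
    (h33 : ∀ j, j ≤ k → ∀ y ∈ Λ j, pdevOn (tlo L y j) (thi L y j) U₀ < α₀ * (((L : ℝ) ^ j)⁻¹) ^ 2)
    (h34 : ∀ j, j ≤ k → ∀ y ∈ Λ j, pdevOn (tlo L y j) (thi L y j) (U' * U₀) < αP * (((L : ℝ) ^ j)⁻¹) ^ 2)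
    (hAx : InAx L k Λ U₀ (U' * U₀)) (h129₁ : Restr129 L k Λ U₀ u₁) (h129₂ : Restr129 L k Λ U₀ u₂)
    (h₁ : mgauge U₀ u₁ (cfgExp η A₁) = U') (h₂ : mgauge U₀ u₂ (cfgExp η A₂) = U')
    (h62₁ : ∀ j, j ≤ k → ∀ y ∈ Λ j, ∀ (x : Site d) (κ : Fin d), InBox (tlo L y j) (thi L y j) x →
      InBox (tlo L y j) (thi L y j) (x + e κ) → ‖A₁ x κ‖ ≤ c * ((L : ℝ) ^ j * η)⁻¹)
    (h62₂ : ∀ j, j ≤ k → ∀ y ∈ Λ j, ∀ (x : Site d) (κ : Fin d), InBox (tlo L y j) (thi L y j) x →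
      InBox (tlo L y j) (thi L y j) (x + e κ) → ‖A₂ x κ‖ ≤ c * ((L : ℝ) ^ j * η)⁻¹)
    (Lan : (Site d → Fin d → 𝔸ˣ) → Prop) (hLan₁ : Lan (cfgExp η A₁)) (hLan₂ : Lan (cfgExp η A₂))
    (hP5u : ∀ (v w : Site d → 𝔸ˣ) (lam mu : Site d → 𝔸),
      (∀ j, j ≤ k → ∀ y ∈ Λ j, ∀ x : Site d, InBox (tlo L y j) (thi L y j) x →
        ((gaugeExp lam x : 𝔸ˣ) : 𝔸) = ((v x : 𝔸ˣ) : 𝔸) ∧ IsSelfAdjoint (lam x) ∧ ‖lam x‖ < cu ∧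
          ∀ κ : Fin d, InBox (tlo L y j) (thi L y j) (x + e κ) → ((L : ℝ) ^ j * η) * ‖covDerivFwd η U₀ κ lam x‖ < cu) →
      (∀ j, j ≤ k → ∀ y ∈ Λ j, ∀ x : Site d, InBox (tlo L y j) (thi L y j) x →
        ((gaugeExp mu x : 𝔸ˣ) : 𝔸) = ((w x : 𝔸ˣ) : 𝔸) ∧ IsSelfAdjoint (mu x) ∧ ‖mu x‖ < cu ∧
          ∀ κ : Fin d, InBox (tlo L y j) (thi L y j) (x + e κ) → ((L : ℝ) ^ j * η) * ‖covDerivFwd η U₀ κ mu x‖ < cu) →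
      Lan (mgauge U₀ v⁻¹ (cfgExp η A₁)) → Restr129 L k Λ U₀ (u₁ * v) →
      Lan (mgauge U₀ w⁻¹ (cfgExp η A₁)) → Restr129 L k Λ U₀ (u₁ * w) →
      ∀ j, j ≤ k → ∀ y ∈ Λ j, ∀ x : Site d, InBox (tlo L y j) (thi L y j) x → v x = w x) :
    ∀ j, j ≤ k → ∀ y ∈ Λ j, ∀ x : Site d, InBox (tlo L y j) (thi L y j) x → u₁ x = u₂ x := by
  have hd' : (1 : ℝ) ≤ d := by exact_mod_cast hd
  have ha₃0 : 0 ≤ 40 * d * c := by positivity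
  set lam : Site d → 𝔸 := fun z => (I⁻¹ : ℂ) • mlog ((((u₁⁻¹ * u₂) z : 𝔸ˣ)) : 𝔸) with hlam
  -- `u′ = e^{iλ′}` on the towers with `λ′` in the domain (1.109)
  have hdom : ∀ j, j ≤ k → ∀ y ∈ Λ j, ∀ x : Site d, InBox (tlo L y j) (thi L y j) x →
      ((gaugeExp lam x : 𝔸ˣ) : 𝔸) = (((u₁⁻¹ * u₂) x : 𝔸ˣ) : 𝔸) ∧ IsSelfAdjoint (lam x) ∧ ‖lam x‖ < cu ∧
        ∀ κ : Fin d, InBox (tlo L y j) (thi L y j) (x + e κ) → ((L : ℝ) ^ j * η) * ‖covDerivFwd η U₀ κ lam x‖ < cu := by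
    intro j hjk y hy x hx
    obtain ⟨he, hsa, hn, hD⟩ := lam_in_domain_local hd hL hL1 hη hU₀ hU' hu₁ hu₂ hα hα3 hα4 hc hsmall hc₃ hsm hα₃ hαP hαP3 hαP2
      hAx h129₁ h129₂ h₁ h₂ hjk hy (h33 j hjk y hy) (h34 j hjk y hy) (h62₁ j hjk y hy) (h62₂ j hjk y hy) x hx
    exact ⟨he, hsa, lt_of_le_of_lt hn hcu₁, fun κ hxe => lt_of_le_of_lt (hD κ hxe) hcu₂⟩
  -- «a configuration identically equal to 1 is a solution also»: `1 = e^{i0}`, `0` in the domain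
  have hcu : 0 < cu := lt_of_le_of_lt (by positivity) hcu₂
  have hdom1 : ∀ j, j ≤ k → ∀ y ∈ Λ j, ∀ x : Site d, InBox (tlo L y j) (thi L y j) x →
      ((gaugeExp (fun _ => (0 : 𝔸)) x : 𝔸ˣ) : 𝔸) = (((1 : Site d → 𝔸ˣ) x : 𝔸ˣ) : 𝔸) ∧ IsSelfAdjoint ((fun _ => (0 : 𝔸)) x) ∧
        ‖(fun _ => (0 : 𝔸)) x‖ < cu ∧
        ∀ κ : Fin d, InBox (tlo L y j) (thi L y j) (x + e κ) →
          ((L : ℝ) ^ j * η) * ‖covDerivFwd η U₀ κ (fun _ => (0 : 𝔸)) x‖ < cu := by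
    intro j _ y _ x _
    refine ⟨?_, IsSelfAdjoint.zero 𝔸, by simpa using hcu, fun κ _ => ?_⟩
    · rw [gaugeExp, smul_zero, B7Prop8Flat.expUnit_zero, Pi.one_apply]
    · have h0 : covDerivFwd η U₀ κ (fun _ => (0 : 𝔸)) x = 0 := by
        rw [covDerivFwd, B7Eq78Linearization.conjR_apply, mul_zero, zero_mul, sub_zero, smul_zero]
      rw [h0, norm_zero, mul_zero]
      exact hcu
  -- `u′` solves (1.107): `U₁^{u′⁻¹} = U₂` is in the Landau gauge, `u₁u′ = u₂` satisfies (1.29)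
  have hq : mgauge U₀ (u₁⁻¹ * u₂)⁻¹ (cfgExp η A₁) = cfgExp η A₂ := mgauge_quotient_eq U₀ u₁ u₂ _ _ U' h₁ h₂
  have hLan' : Lan (mgauge U₀ (u₁⁻¹ * u₂)⁻¹ (cfgExp η A₁)) := by rw [hq]; exact hLan₂
  have h129' : Restr129 L k Λ U₀ (u₁ * (u₁⁻¹ * u₂)) := by rw [mul_inv_cancel_left]; exact h129₂
  -- `1` solves (1.107): `U₁^{1⁻¹} = U₁`, `u₁·1 = u₁`
  have hLan1 : Lan (mgauge U₀ (1 : Site d → 𝔸ˣ)⁻¹ (cfgExp η A₁)) := by rw [inv_one, mgauge_one_gt]; exact hLan₁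
  have h1291 : Restr129 L k Λ U₀ (u₁ * 1) := by rw [mul_one]; exact h129₁
  -- Proposition 5's uniqueness: `u′ = 1` on the towers
  have huniq := hP5u (u₁⁻¹ * u₂) 1 lam (fun _ => 0) hdom hdom1 hLan' h129' hLan1 h1291
  intro j hjk y hy x hx
  have h := huniq j hjk y hy x hx
  rw [Pi.mul_apply, Pi.inv_apply, Pi.one_apply, inv_mul_eq_one] at h
  exact h

end Main

/-! ## §5 (v2) The same clause with `U_i = e^{iηA_i}` READ ON THE TOWERS ONLY (the form a B8 family carried by `Ω₀` consumes)

APPEND-ONLY v2 (same seat, same day).  In §2–§4 the representation `U_i = U′^{u_i⁻¹} = e^{iηA_i}` is a GLOBAL identity of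
configurations on `ℤᵈ` (`mgauge U₀ u_i (cfgExp η A_i) = U′`).  Print reads (1.62) — hence the logarithm `A_i` — on `Ω_j` only, and a
family of record with general admissible domain sequences can only supply `U_i = e^{iηA_i}` ON THE BONDS OF `Ω₀ ⊇ Bʲ(Λ_j)` (off `Ω₀` a
unitary `U_i(b)` need not be an exponential of the series logarithm).  This section re-runs §2–§4 from that weaker reading: `U_i` is any
configuration with `U′ = U_i^{u_i}`, AGREEING with `e^{iηA_i}` on the bonds of every tower `Bʲ(y)`, `y ∈ Λ_j` (`B7Prop1Local.AgreeOn`);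
the transfer to `B8Eq1112Local`'s global exponential form is the tree's clamp device (`B7Prop1Local.clampCfg`: `π^*U_i = π^*e^{iηA_i} =
e^{B_i^π}` with `B_i^π` the clamped exponent), all inputs of `eq1112_local_inv_mul` being local on the tower (`B8Ineq133.pdevOn_congr`,
`B8Ineq172Concrete.tHol_block_congr`). -/

section Device2

variable {G : Type*} [Group G] {lo hi : Site d}

/-- `π^*V = π^*W` when `V`, `W` agree on the bonds of the box (the clamp reads box bonds only). [folklore] -/
private theorem clampCfg_congr (hlohi : ∀ i, lo i ≤ hi i) {V W : Site d → Fin d → G} (h : AgreeOn lo hi V W) :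
    clampCfg lo hi V = clampCfg lo hi W := by
  funext x κ
  by_cases hP : lo κ ≤ x κ ∧ x κ < hi κ
  · simp only [clampCfg, hP, and_self, if_true]
    have hx := clamp_inBox hlohi x
    have hxe : InBox lo hi (clamp lo hi x + e κ) := by rw [← clamp_add_e_of hP]; exact clamp_inBox hlohi _
    exact h _ κ hx hxe
  · simp only [clampCfg, hP, if_false]

end Device2

section LocalForm

variable {𝔸 : Type*} [CStarAlgebra 𝔸] [Nontrivial 𝔸]
variable {L k : ℕ} {η : ℝ} {Λ : ℕ → Set (Site d)} {U₀ U' U₁ U₂ : Site d → Fin d → 𝔸ˣ} {α₀ αP c : ℝ}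
  {u₁ u₂ : Site d → 𝔸ˣ} {A₁ A₂ : Site d → Fin d → 𝔸}

omit [Nontrivial 𝔸] in
/-- `π^*(e^{iηA}) = e^{B^π}` for the clamped exponent `B^π(x, κ) = iηA(πx, κ)` on the clamp's bonds, `0` elsewhere (n04-b's device of
`B8Eq1112Local`, re-derived for `cfgExp`). [folklore] -/
private theorem clampCfg_cfgExp (lo hi : Site d) (η : ℝ) (A : Site d → Fin d → 𝔸) :
    clampCfg lo hi (cfgExp η A) = expCfg (fun x κ => if lo κ ≤ x κ ∧ x κ < hi κ then (I : ℂ) • (η • A (clamp lo hi x) κ) else 0) := by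
  funext x κ
  simp only [clampCfg, expCfg, cfgExp]
  split_ifs
  · rfl
  · exact (B7Prop8Flat.expUnit_zero (𝔸 := 𝔸)).symm

omit [Nontrivial 𝔸] in
/-- The clamped exponent inherits (1.62) in the (1.69)-currency: `‖B^π(x, κ)‖ ≤ cL⁻ʲ` everywhere (`c ≥ 0`). [cite: Balaban1985RegularSpaces, (1.62) p.87, (1.69) p.88] -/
private theorem norm_clampExp_le {lo hi : Site d} (hlohi : ∀ i, lo i ≤ hi i) (hη : 0 < η) (hL1 : 1 ≤ L) (j : ℕ) (hc : 0 ≤ c)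
    {A : Site d → Fin d → 𝔸} (hA : ∀ (x : Site d) (κ : Fin d), InBox lo hi x → InBox lo hi (x + e κ) → ‖A x κ‖ ≤ c * ((L : ℝ) ^ j * η)⁻¹)
    (x : Site d) (κ : Fin d) :
    ‖(fun x κ => if lo κ ≤ x κ ∧ x κ < hi κ then (I : ℂ) • (η • A (clamp lo hi x) κ) else (0 : 𝔸)) x κ‖ ≤ c * ((L : ℝ) ^ j)⁻¹ := by
  have hLr : (1 : ℝ) ≤ L := by exact_mod_cast hL1
  have hb : 0 ≤ c * ((L : ℝ) ^ j)⁻¹ := by positivity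
  by_cases hP : lo κ ≤ x κ ∧ x κ < hi κ
  · simp only [hP, and_self, if_true]
    have hx := clamp_inBox hlohi x
    have hxe : InBox lo hi (clamp lo hi x + e κ) := by rw [← clamp_add_e_of hP]; exact clamp_inBox hlohi _
    exact norm_smul_le_of_62 hη hL1 j (hA _ κ hx hxe)
  · simp only [hP, if_false, norm_zero]
    exact hb

/-- **(1.112) AT THE FINE LEVEL, `U_i = e^{iηA_i}` READ ON THE TOWER ONLY.**  As `quotient_sub_one_le_local`, with `U′ = U_i^{u_i}` for
configurations `U_i` that AGREE with `e^{iηA_i}` on the bonds of the tower `Bʲ(y)` (and (1.62) for `A_i` there): `‖(u₁⁻¹u₂)(x) − 1‖ ≤ α₃′`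
at every `x ∈ Bʲ(y)`.  Transfer: `π^*U_i = e^{B_i^π}` is a global exponential field, unitary-valued, agreeing with `U_i` on the tower, so
every (local) hypothesis of `B8Eq1112Local.eq1112_local_inv_mul` for `(u_i, e^{B_i^π})` is that of `(u_i, U_i)`.
[cite: Balaban1985RegularSpaces, (1.112) p.95, (1.73) p.88, (1.62) p.87; Balaban1985Averaging, Proposition 8 p.45, p.24] -/
theorem quotient_sub_one_le_of_agree (hd : 1 ≤ d) (hL : 2 ≤ L) (hL1 : 1 ≤ L) (hη : 0 < η)
    (hU₀ : ∀ x κ, U₀ x κ ∈ unitaryUnits 𝔸) (hU' : ∀ x κ, U' x κ ∈ unitaryUnits 𝔸)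
    (hu₁ : ∀ x, u₁ x ∈ unitaryUnits 𝔸) (hu₂ : ∀ x, u₂ x ∈ unitaryUnits 𝔸)
    (hα : 0 < α₀) (hα3 : C0 d * α₀ ≤ 1 / 3) (hα4 : 4 * α₀ ≤ c2' d L) (hc : 0 ≤ c)
    (hsmall : Real.exp (4 * (800 * ((d : ℝ) + 1) ^ 2 * ((d : ℝ) + 4)) * α₀) * (1 + 8 * (131072 * ((d : ℝ) + 1) ^ 2) * c) ≤ 2)
    (hc₃ : 2 * c ≤ c3 d L) (hsm : 2048 * (d : ℝ) * c ≤ 1) (hα₃ : 40 * d * c ≤ 1 / 3000)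
    (hαP : 0 < αP) (hαP3 : C0 d * αP ≤ 1 / 3) (hαP2 : 2 * αP ≤ c2' d L)
    (hAx : InAx L k Λ U₀ (U' * U₀)) (h129₁ : Restr129 L k Λ U₀ u₁) (h129₂ : Restr129 L k Λ U₀ u₂)
    (h₁ : mgauge U₀ u₁ U₁ = U') (h₂ : mgauge U₀ u₂ U₂ = U')
    {j : ℕ} (hjk : j ≤ k) {y : Site d} (hy : y ∈ Λ j)
    (h33 : pdevOn (tlo L y j) (thi L y j) U₀ < α₀ * (((L : ℝ) ^ j)⁻¹) ^ 2)
    (h34 : pdevOn (tlo L y j) (thi L y j) (U' * U₀) < αP * (((L : ℝ) ^ j)⁻¹) ^ 2)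
    (hA₁ : AgreeOn (tlo L y j) (thi L y j) U₁ (cfgExp η A₁)) (hA₂ : AgreeOn (tlo L y j) (thi L y j) U₂ (cfgExp η A₂))
    (h62₁ : ∀ (x : Site d) (κ : Fin d), InBox (tlo L y j) (thi L y j) x → InBox (tlo L y j) (thi L y j) (x + e κ) →
      ‖A₁ x κ‖ ≤ c * ((L : ℝ) ^ j * η)⁻¹)
    (h62₂ : ∀ (x : Site d) (κ : Fin d), InBox (tlo L y j) (thi L y j) x → InBox (tlo L y j) (thi L y j) (x + e κ) →
      ‖A₂ x κ‖ ≤ c * ((L : ℝ) ^ j * η)⁻¹)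
    (x : Site d) (hx : InBox (tlo L y j) (thi L y j) x) :
    ‖(((u₁⁻¹ * u₂) x : 𝔸ˣ) : 𝔸) - 1‖ ≤ 2 * (40 * d * c) + 2 * 1116 * (40 * d * c) ^ 2 := by
  have hlohi : ∀ i, tlo L y j i ≤ thi L y j i := B8Ineq130.tlo_le_thi hL1 le_rfl j
  have hG : AvgClosed d L (unitaryUnits 𝔸) := avgClosed_unitaryUnits d L
  -- the clamped exponents `B_i^π` and the global exponential fields `e^{B_i^π} = π^*U_i`
  set B₁ : Site d → Fin d → 𝔸 :=
    fun x κ => if tlo L y j κ ≤ x κ ∧ x κ < thi L y j κ then (I : ℂ) • (η • A₁ (clamp (tlo L y j) (thi L y j) x) κ) else 0 with hB₁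
  set B₂ : Site d → Fin d → 𝔸 :=
    fun x κ => if tlo L y j κ ≤ x κ ∧ x κ < thi L y j κ then (I : ℂ) • (η • A₂ (clamp (tlo L y j) (thi L y j) x) κ) else 0 with hB₂
  have hUi : ∀ {u : Site d → 𝔸ˣ} {Ui : Site d → Fin d → 𝔸ˣ}, (∀ x, u x ∈ unitaryUnits 𝔸) → mgauge U₀ u Ui = U' →
      mgauge U₀ u⁻¹ U' = Ui ∧ ∀ (x : Site d) (κ : Fin d), Ui x κ ∈ unitaryUnits 𝔸 := by
    intro u Ui hu h
    have hinv : mgauge U₀ u⁻¹ U' = Ui := mgauge_inv_of_eq U₀ u Ui U' h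
    refine ⟨hinv, fun x κ => ?_⟩
    rw [← hinv, mgauge_apply, Pi.inv_apply]
    refine (unitaryUnits 𝔸).mul_mem ((unitaryUnits 𝔸).mul_mem ((unitaryUnits 𝔸).inv_mem (hu x)) (hU' x κ)) ?_
    refine (unitaryUnits 𝔸).inv_mem ?_
    rw [Rc_apply, Pi.inv_apply]
    exact (unitaryUnits 𝔸).mul_mem ((unitaryUnits 𝔸).mul_mem (hU₀ x κ) ((unitaryUnits 𝔸).inv_mem (hu _)))
      ((unitaryUnits 𝔸).inv_mem (hU₀ x κ))
  obtain ⟨hinv₁, hU₁u⟩ := hUi hu₁ h₁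
  obtain ⟨hinv₂, hU₂u⟩ := hUi hu₂ h₂
  have hE₁ : expCfg B₁ = clampCfg (tlo L y j) (thi L y j) U₁ := by
    rw [hB₁, ← clampCfg_cfgExp, clampCfg_congr hlohi hA₁]
  have hE₂ : expCfg B₂ = clampCfg (tlo L y j) (thi L y j) U₂ := by
    rw [hB₂, ← clampCfg_cfgExp, clampCfg_congr hlohi hA₂]
  have hag₁ : AgreeOn (tlo L y j) (thi L y j) (expCfg B₁) U₁ := by rw [hE₁]; exact clampCfg_agree U₁
  have hag₂ : AgreeOn (tlo L y j) (thi L y j) (expCfg B₂) U₂ := by rw [hE₂]; exact clampCfg_agree U₂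
  have hBu₁ : ∀ (x : Site d) (κ : Fin d), expCfg B₁ x κ ∈ unitaryUnits 𝔸 := fun x κ => by rw [hE₁]; exact clampCfg_mem hU₁u x κ
  have hBu₂ : ∀ (x : Site d) (κ : Fin d), expCfg B₂ x κ ∈ unitaryUnits 𝔸 := fun x κ => by rw [hE₂]; exact clampCfg_mem hU₂u x κ
  have h69₁ : ∀ (x : Site d) (κ : Fin d), InBox (tlo L y j) (thi L y j) x → InBox (tlo L y j) (thi L y j) (x + e κ) →
      ‖B₁ x κ‖ ≤ c * ((L : ℝ) ^ j)⁻¹ := fun x κ _ _ => norm_clampExp_le hlohi hη hL1 j hc h62₁ x κ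
  have h69₂ : ∀ (x : Site d) (κ : Fin d), InBox (tlo L y j) (thi L y j) x → InBox (tlo L y j) (thi L y j) (x + e κ) →
      ‖B₂ x κ‖ ≤ c * ((L : ℝ) ^ j)⁻¹ := fun x κ _ _ => norm_clampExp_le hlohi hη hL1 j hc h62₂ x κ
  -- regularity of `e^{B_i^π}U₀` on the tower = that of `U_iU₀ = (U′U₀)^{u_i⁻¹}` = that of `U′U₀`
  have hrefl : AgreeOn (tlo L y j) (thi L y j) U₀ U₀ := fun _ _ _ _ => rfl
  have hP : ∀ {u : Site d → 𝔸ˣ} {Ui : Site d → Fin d → 𝔸ˣ} {Bi : Site d → Fin d → 𝔸}, (∀ x, u x ∈ unitaryUnits 𝔸) →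
      mgauge U₀ u⁻¹ U' = Ui → AgreeOn (tlo L y j) (thi L y j) (expCfg Bi) Ui →
      pdevOn (tlo L y j) (thi L y j) (expCfg Bi * U₀) < αP * (((L : ℝ) ^ j)⁻¹) ^ 2 := by
    intro u Ui Bi hu hinv hag
    have hu' : ∀ x, u⁻¹ x ∈ U1 𝔸 := fun x => by rw [Pi.inv_apply]; exact hG.le_U1 ((unitaryUnits 𝔸).inv_mem (hu x))
    rw [B8Ineq133.pdevOn_congr (B7LocalityGeneral.agreeOn_mul hag hrefl), ← hinv, mgauge_mul,
      B8Eq115GaugeFixing.pdevOn_gaugeAct hu']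
    exact h34
  have hP₁ := hP hu₁ hinv₁ hag₁
  have hP₂ := hP hu₂ hinv₂ hag₂
  -- the block axial gauge (1.19) of `U′` on the tower, read for `(e^{B_i^π})^{u_i}` (which agrees with `U′ = U_i^{u_i}` there)
  have hax : ∀ {u : Site d → 𝔸ˣ} {Ui : Site d → Fin d → 𝔸ˣ} {Bi : Site d → Fin d → 𝔸}, mgauge U₀ u Ui = U' →
      AgreeOn (tlo L y j) (thi L y j) (expCfg Bi) Ui →
      ∀ n, n < j → ∀ z : Site d, Under L (j - (n + 1)) y z → ∀ r : Fin d → Fin L,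
        tHol (avgIter L U₀ n) (tildIter L U₀ (mgauge U₀ u (expCfg Bi)) n) ((L : ℤ) • z) (treeWord (boxVec L r)) = 1 := by
    intro u Ui Bi h hag n hn z hz r
    have hag' : AgreeOn (tlo L y j) (thi L y j) (mgauge U₀ u (expCfg Bi)) U' := by
      intro q κ hq hqκ
      rw [← h, mgauge_apply, mgauge_apply, hag q κ hq hqκ]
    obtain ⟨hz1, hz2⟩ := (under_iff_tower L (j - (n + 1)) y z).1 hz
    rw [B8Ineq172Concrete.tHol_block_congr hL1 hrefl hag' (show (j - (n + 1)) + (n + 1) = j by omega) hz1 hz2 r]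
    exact (ax119_iff_ax67 L U₀ U' n z r).1 (hAx j (by omega) hjk y hy n hn z hz r)
  have h129₁' : uavg L U₀ u₁ j y = 1 := (restr129_iff_uavg L k Λ U₀ u₁).1 h129₁ j hjk y hy
  have h129₂' : uavg L U₀ u₂ j y = 1 := (restr129_iff_uavg L k Λ U₀ u₂).1 h129₂ j hjk y hy
  obtain ⟨h173, -⟩ := eq1112_local_inv_mul hd hL hU₀ hα hα3 hα4 h33 hc hsmall hc₃ hsm hα₃ hαP hαP3 hαP2 hL1 hBu₁ hBu₂
    h69₁ h69₂ hP₁ hP₂ (hax h₁ hag₁) (hax h₂ hag₂) h129₁' h129₂'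
  obtain ⟨hx1, hx2⟩ := (inBox_iff_le L j y x).1 hx
  have h := h173 0 j (by omega) x hx1 hx2
  rwa [uavg_zero] at h

/-- **`λ′ := (1/i) log u′` ON THE TOWERS, `U_i = e^{iηA_i}` READ ON THE TOWER ONLY** — as `lam_in_domain_local`: `e^{iλ′} = u′`, `λ′`
self-adjoint, `‖λ′‖ ≤ 2α₃′` at the sites and `(Lʲη)‖(Dλ′)(b)‖ ≤ 5c` at the bonds of `Bʲ(y)`, `y ∈ Λ_j` (`α₃ ≤ 1/5000`); the identity
`U₁^{u′⁻¹} = U₂` of (1.112) is read at the bond where both `U_i` equal `e^{iηA_i}`. [cite: Balaban1985RegularSpaces, p.95 (after (1.112)), (1.109) p.94, (1.84) p.90, (1.62) p.87] -/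
theorem lam_in_domain_of_agree (hd : 1 ≤ d) (hL : 2 ≤ L) (hL1 : 1 ≤ L) (hη : 0 < η)
    (hU₀ : ∀ x κ, U₀ x κ ∈ unitaryUnits 𝔸) (hU' : ∀ x κ, U' x κ ∈ unitaryUnits 𝔸)
    (hu₁ : ∀ x, u₁ x ∈ unitaryUnits 𝔸) (hu₂ : ∀ x, u₂ x ∈ unitaryUnits 𝔸)
    (hα : 0 < α₀) (hα3 : C0 d * α₀ ≤ 1 / 3) (hα4 : 4 * α₀ ≤ c2' d L) (hc : 0 ≤ c)
    (hsmall : Real.exp (4 * (800 * ((d : ℝ) + 1) ^ 2 * ((d : ℝ) + 4)) * α₀) * (1 + 8 * (131072 * ((d : ℝ) + 1) ^ 2) * c) ≤ 2)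
    (hc₃ : 2 * c ≤ c3 d L) (hsm : 2048 * (d : ℝ) * c ≤ 1) (hα₃ : 40 * d * c ≤ 1 / 5000)
    (hαP : 0 < αP) (hαP3 : C0 d * αP ≤ 1 / 3) (hαP2 : 2 * αP ≤ c2' d L)
    (hAx : InAx L k Λ U₀ (U' * U₀)) (h129₁ : Restr129 L k Λ U₀ u₁) (h129₂ : Restr129 L k Λ U₀ u₂)
    (h₁ : mgauge U₀ u₁ U₁ = U') (h₂ : mgauge U₀ u₂ U₂ = U')
    {j : ℕ} (hjk : j ≤ k) {y : Site d} (hy : y ∈ Λ j)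
    (h33 : pdevOn (tlo L y j) (thi L y j) U₀ < α₀ * (((L : ℝ) ^ j)⁻¹) ^ 2)
    (h34 : pdevOn (tlo L y j) (thi L y j) (U' * U₀) < αP * (((L : ℝ) ^ j)⁻¹) ^ 2)
    (hA₁ : AgreeOn (tlo L y j) (thi L y j) U₁ (cfgExp η A₁)) (hA₂ : AgreeOn (tlo L y j) (thi L y j) U₂ (cfgExp η A₂))
    (h62₁ : ∀ (x : Site d) (κ : Fin d), InBox (tlo L y j) (thi L y j) x → InBox (tlo L y j) (thi L y j) (x + e κ) →
      ‖A₁ x κ‖ ≤ c * ((L : ℝ) ^ j * η)⁻¹)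
    (h62₂ : ∀ (x : Site d) (κ : Fin d), InBox (tlo L y j) (thi L y j) x → InBox (tlo L y j) (thi L y j) (x + e κ) →
      ‖A₂ x κ‖ ≤ c * ((L : ℝ) ^ j * η)⁻¹)
    (x : Site d) (hx : InBox (tlo L y j) (thi L y j) x) :
    ((gaugeExp (fun z => (I⁻¹ : ℂ) • mlog ((((u₁⁻¹ * u₂) z : 𝔸ˣ)) : 𝔸)) x : 𝔸ˣ) : 𝔸) = (((u₁⁻¹ * u₂) x : 𝔸ˣ) : 𝔸) ∧
      IsSelfAdjoint ((I⁻¹ : ℂ) • mlog ((((u₁⁻¹ * u₂) x : 𝔸ˣ)) : 𝔸)) ∧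
      ‖(I⁻¹ : ℂ) • mlog ((((u₁⁻¹ * u₂) x : 𝔸ˣ)) : 𝔸)‖ ≤ 2 * (2 * (40 * d * c) + 2 * 1116 * (40 * d * c) ^ 2) ∧
      ∀ κ : Fin d, InBox (tlo L y j) (thi L y j) (x + e κ) →
        ((L : ℝ) ^ j * η) * ‖covDerivFwd η U₀ κ (fun z => (I⁻¹ : ℂ) • mlog ((((u₁⁻¹ * u₂) z : 𝔸ˣ)) : 𝔸)) x‖ ≤ 5 * c := by
  have hd' : (1 : ℝ) ≤ d := by exact_mod_cast hd
  have hα₃' : 40 * d * c ≤ 1 / 3000 := hα₃.trans (by norm_num)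
  set a₃ : ℝ := 2 * (40 * d * c) + 2 * 1116 * (40 * d * c) ^ 2 with ha₃
  have ha₃0 : 0 ≤ 40 * d * c := by positivity
  have ha₃le : a₃ ≤ 1 / 2000 := by rw [ha₃]; nlinarith
  set lam : Site d → 𝔸 := fun z => (I⁻¹ : ℂ) • mlog ((((u₁⁻¹ * u₂) z : 𝔸ˣ)) : 𝔸) with hlam
  have h173 : ∀ z : Site d, InBox (tlo L y j) (thi L y j) z → ‖(((u₁⁻¹ * u₂) z : 𝔸ˣ) : 𝔸) - 1‖ ≤ a₃ := fun z hz =>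
    quotient_sub_one_le_of_agree hd hL hL1 hη hU₀ hU' hu₁ hu₂ hα hα3 hα4 hc hsmall hc₃ hsm hα₃' hαP hαP3 hαP2 hAx h129₁ h129₂ h₁
      h₂ hjk hy h33 h34 hA₁ hA₂ h62₁ h62₂ z hz
  have hlog : ∀ z : Site d, InBox (tlo L y j) (thi L y j) z →
      ((gaugeExp lam z : 𝔸ˣ) : 𝔸) = (((u₁⁻¹ * u₂) z : 𝔸ˣ) : 𝔸) ∧ ‖lam z‖ ≤ 2 * a₃ := by
    intro z hz
    have hz' : ‖(((u₁⁻¹ * u₂) z : 𝔸ˣ) : 𝔸) - 1‖ ≤ 1 / 2 := (h173 z hz).trans (ha₃le.trans (by norm_num))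
    obtain ⟨he, hn⟩ := lam_of_unit ((u₁⁻¹ * u₂) z) hz'
    refine ⟨?_, hn.trans (by linarith [h173 z hz])⟩
    rw [gaugeExp]
    exact he
  have hsa : IsSelfAdjoint (lam x) := by
    have hux : (((u₁⁻¹ * u₂) x : 𝔸ˣ) : 𝔸) ∈ unitary 𝔸 :=
      mem_unitaryUnits.1 ((unitaryUnits 𝔸).mul_mem ((unitaryUnits 𝔸).inv_mem (hu₁ x)) (hu₂ x))
    have h4 : ‖(((u₁⁻¹ * u₂) x : 𝔸ˣ) : 𝔸) - 1‖ ≤ 1 / 4 := (h173 x hx).trans (ha₃le.trans (by norm_num))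
    show star (lam x) = lam x
    rw [hlam]
    simp only
    rw [star_smul, star_mlog_eq_neg hux h4, Complex.inv_I, Complex.star_def, map_neg, Complex.conj_I, neg_neg, smul_neg,
      neg_smul]
  obtain ⟨hex, hnx⟩ := hlog x hx
  refine ⟨hex, hsa, hnx, fun κ hxe => ?_⟩
  obtain ⟨hexe, hnxe⟩ := hlog (x + e κ) hxe
  -- `U₁^{u′⁻¹} = U₂` ((1.112)) at the bond, where `U_i = e^{iηA_i}` and `e^{iλ′} = u′` at both ends
  have hq : mgauge U₀ (u₁⁻¹ * u₂)⁻¹ U₁ = U₂ := mgauge_quotient_eq U₀ u₁ u₂ U₁ U₂ U' h₁ h₂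
  have hux : gaugeExp lam x = (u₁⁻¹ * u₂) x := Units.ext hex
  have huxe : gaugeExp lam (x + e κ) = (u₁⁻¹ * u₂) (x + e κ) := Units.ext hexe
  have hU₁₂ : mgauge U₀ (fun z => (gaugeExp lam z)⁻¹) (cfgExp η A₁) x κ = cfgExp η A₂ x κ := by
    rw [← hA₂ x κ hx hxe, ← hq, mgauge_apply, mgauge_apply, hux, huxe, Pi.inv_apply, Pi.inv_apply, hA₁ x κ hx hxe]
  have hG : AvgClosed d L (unitaryUnits 𝔸) := avgClosed_unitaryUnits d L
  have hUx : U₀ x κ ∈ U1 𝔸 := hG.le_U1 (hU₀ x κ)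
  have hs : 2 * a₃ ≤ 1 / 1000 := by linarith
  have hc170 : c * ((L : ℝ) ^ j)⁻¹ ≤ 1 / 170 := by
    have hLr : (1 : ℝ) ≤ L := by exact_mod_cast hL1
    have hLj : (1 : ℝ) ≤ (L : ℝ) ^ j := one_le_pow₀ hLr
    have hinv : ((L : ℝ) ^ j)⁻¹ ≤ 1 := inv_le_one_of_one_le₀ hLj
    have hc' : c ≤ 1 / 170 := by nlinarith
    calc c * ((L : ℝ) ^ j)⁻¹ ≤ c * 1 := mul_le_mul_of_nonneg_left hinv hc
      _ ≤ 1 / 170 := by linarith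
  exact ineq1109_scaled hη U₀ A₁ A₂ κ hUx hL1 hs hnx hnxe (h62₁ x κ hx hxe) (h62₂ x κ hx hxe) hc170 hU₁₂

/-- **THEOREM 4, UNIQUENESS CLAUSE, `U_i = e^{iηA_i}` READ ON THE TOWERS ONLY** — as `thm4_unique_local`, for configurations
`U_i = U′^{u_i⁻¹}` that AGREE with `e^{iηA_i}` on the bonds of every tower `Bʲ(y)`, `y ∈ Λ_j`, `j ≤ k` (print's «U_i = e^{iηA_i}` with
(1.62) on `Ω_j`), in the Landau gauge `Lan U_i`; Proposition 5's uniqueness clause `hP5u` for the datum `(U₀, U₁, u₁)` as in §4 with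
`Lan (U₁^{v⁻¹})`.  CONCLUSION: `u₁ = u₂` on every `Bʲ(y)`, `y ∈ Λ_j`, `j ≤ k`.  This is the form consumable by a B8 family whose gauge
transformations and logarithms are carried by `Ω₀` (READING (ii) of the module docstring). [cite: Balaban1985RegularSpaces, Thm 4 p.88, proof p.95 (1.112), Prop. 5 (1.107)–(1.109) p.94] -/
theorem thm4_unique_of_agree (hd : 1 ≤ d) (hL : 2 ≤ L) (hL1 : 1 ≤ L) (hη : 0 < η)
    (hU₀ : ∀ x κ, U₀ x κ ∈ unitaryUnits 𝔸) (hU' : ∀ x κ, U' x κ ∈ unitaryUnits 𝔸)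
    (hu₁ : ∀ x, u₁ x ∈ unitaryUnits 𝔸) (hu₂ : ∀ x, u₂ x ∈ unitaryUnits 𝔸)
    (hα : 0 < α₀) (hα3 : C0 d * α₀ ≤ 1 / 3) (hα4 : 4 * α₀ ≤ c2' d L) (hc : 0 ≤ c)
    (hsmall : Real.exp (4 * (800 * ((d : ℝ) + 1) ^ 2 * ((d : ℝ) + 4)) * α₀) * (1 + 8 * (131072 * ((d : ℝ) + 1) ^ 2) * c) ≤ 2)
    (hc₃ : 2 * c ≤ c3 d L) (hsm : 2048 * (d : ℝ) * c ≤ 1) (hα₃ : 40 * d * c ≤ 1 / 5000)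
    (hαP : 0 < αP) (hαP3 : C0 d * αP ≤ 1 / 3) (hαP2 : 2 * αP ≤ c2' d L)
    {cu : ℝ} (hcu₁ : 2 * (2 * (40 * d * c) + 2 * 1116 * (40 * d * c) ^ 2) < cu) (hcu₂ : 5 * c < cu)
    (h33 : ∀ j, j ≤ k → ∀ y ∈ Λ j, pdevOn (tlo L y j) (thi L y j) U₀ < α₀ * (((L : ℝ) ^ j)⁻¹) ^ 2)
    (h34 : ∀ j, j ≤ k → ∀ y ∈ Λ j, pdevOn (tlo L y j) (thi L y j) (U' * U₀) < αP * (((L : ℝ) ^ j)⁻¹) ^ 2)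
    (hAx : InAx L k Λ U₀ (U' * U₀)) (h129₁ : Restr129 L k Λ U₀ u₁) (h129₂ : Restr129 L k Λ U₀ u₂)
    (h₁ : mgauge U₀ u₁ U₁ = U') (h₂ : mgauge U₀ u₂ U₂ = U')
    (hA₁ : ∀ j, j ≤ k → ∀ y ∈ Λ j, AgreeOn (tlo L y j) (thi L y j) U₁ (cfgExp η A₁))
    (hA₂ : ∀ j, j ≤ k → ∀ y ∈ Λ j, AgreeOn (tlo L y j) (thi L y j) U₂ (cfgExp η A₂))
    (h62₁ : ∀ j, j ≤ k → ∀ y ∈ Λ j, ∀ (x : Site d) (κ : Fin d), InBox (tlo L y j) (thi L y j) x →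
      InBox (tlo L y j) (thi L y j) (x + e κ) → ‖A₁ x κ‖ ≤ c * ((L : ℝ) ^ j * η)⁻¹)
    (h62₂ : ∀ j, j ≤ k → ∀ y ∈ Λ j, ∀ (x : Site d) (κ : Fin d), InBox (tlo L y j) (thi L y j) x →
      InBox (tlo L y j) (thi L y j) (x + e κ) → ‖A₂ x κ‖ ≤ c * ((L : ℝ) ^ j * η)⁻¹)
    (Lan : (Site d → Fin d → 𝔸ˣ) → Prop) (hLan₁ : Lan U₁) (hLan₂ : Lan U₂)
    (hP5u : ∀ (v w : Site d → 𝔸ˣ) (lam mu : Site d → 𝔸),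
      (∀ j, j ≤ k → ∀ y ∈ Λ j, ∀ x : Site d, InBox (tlo L y j) (thi L y j) x →
        ((gaugeExp lam x : 𝔸ˣ) : 𝔸) = ((v x : 𝔸ˣ) : 𝔸) ∧ IsSelfAdjoint (lam x) ∧ ‖lam x‖ < cu ∧
          ∀ κ : Fin d, InBox (tlo L y j) (thi L y j) (x + e κ) → ((L : ℝ) ^ j * η) * ‖covDerivFwd η U₀ κ lam x‖ < cu) →
      (∀ j, j ≤ k → ∀ y ∈ Λ j, ∀ x : Site d, InBox (tlo L y j) (thi L y j) x →
        ((gaugeExp mu x : 𝔸ˣ) : 𝔸) = ((w x : 𝔸ˣ) : 𝔸) ∧ IsSelfAdjoint (mu x) ∧ ‖mu x‖ < cu ∧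
          ∀ κ : Fin d, InBox (tlo L y j) (thi L y j) (x + e κ) → ((L : ℝ) ^ j * η) * ‖covDerivFwd η U₀ κ mu x‖ < cu) →
      Lan (mgauge U₀ v⁻¹ U₁) → Restr129 L k Λ U₀ (u₁ * v) →
      Lan (mgauge U₀ w⁻¹ U₁) → Restr129 L k Λ U₀ (u₁ * w) →
      ∀ j, j ≤ k → ∀ y ∈ Λ j, ∀ x : Site d, InBox (tlo L y j) (thi L y j) x → v x = w x) :
    ∀ j, j ≤ k → ∀ y ∈ Λ j, ∀ x : Site d, InBox (tlo L y j) (thi L y j) x → u₁ x = u₂ x := by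
  have hd' : (1 : ℝ) ≤ d := by exact_mod_cast hd
  have ha₃0 : 0 ≤ 40 * d * c := by positivity
  set lam : Site d → 𝔸 := fun z => (I⁻¹ : ℂ) • mlog ((((u₁⁻¹ * u₂) z : 𝔸ˣ)) : 𝔸) with hlam
  have hdom : ∀ j, j ≤ k → ∀ y ∈ Λ j, ∀ x : Site d, InBox (tlo L y j) (thi L y j) x →
      ((gaugeExp lam x : 𝔸ˣ) : 𝔸) = (((u₁⁻¹ * u₂) x : 𝔸ˣ) : 𝔸) ∧ IsSelfAdjoint (lam x) ∧ ‖lam x‖ < cu ∧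
        ∀ κ : Fin d, InBox (tlo L y j) (thi L y j) (x + e κ) → ((L : ℝ) ^ j * η) * ‖covDerivFwd η U₀ κ lam x‖ < cu := by
    intro j hjk y hy x hx
    obtain ⟨he, hsa, hn, hD⟩ := lam_in_domain_of_agree hd hL hL1 hη hU₀ hU' hu₁ hu₂ hα hα3 hα4 hc hsmall hc₃ hsm hα₃ hαP hαP3
      hαP2 hAx h129₁ h129₂ h₁ h₂ hjk hy (h33 j hjk y hy) (h34 j hjk y hy) (hA₁ j hjk y hy) (hA₂ j hjk y hy) (h62₁ j hjk y hy)
      (h62₂ j hjk y hy) x hx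
    exact ⟨he, hsa, lt_of_le_of_lt hn hcu₁, fun κ hxe => lt_of_le_of_lt (hD κ hxe) hcu₂⟩
  have hcu : 0 < cu := lt_of_le_of_lt (by positivity) hcu₂
  have hdom1 : ∀ j, j ≤ k → ∀ y ∈ Λ j, ∀ x : Site d, InBox (tlo L y j) (thi L y j) x →
      ((gaugeExp (fun _ => (0 : 𝔸)) x : 𝔸ˣ) : 𝔸) = (((1 : Site d → 𝔸ˣ) x : 𝔸ˣ) : 𝔸) ∧ IsSelfAdjoint ((fun _ => (0 : 𝔸)) x) ∧
        ‖(fun _ => (0 : 𝔸)) x‖ < cu ∧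
        ∀ κ : Fin d, InBox (tlo L y j) (thi L y j) (x + e κ) →
          ((L : ℝ) ^ j * η) * ‖covDerivFwd η U₀ κ (fun _ => (0 : 𝔸)) x‖ < cu := by
    intro j _ y _ x _
    refine ⟨?_, IsSelfAdjoint.zero 𝔸, by simpa using hcu, fun κ _ => ?_⟩
    · rw [gaugeExp, smul_zero, B7Prop8Flat.expUnit_zero, Pi.one_apply]
    · have h0 : covDerivFwd η U₀ κ (fun _ => (0 : 𝔸)) x = 0 := by
        rw [covDerivFwd, B7Eq78Linearization.conjR_apply, mul_zero, zero_mul, sub_zero, smul_zero]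
      rw [h0, norm_zero, mul_zero]
      exact hcu
  -- `u′` solves (1.107): `U₁^{u′⁻¹} = U₂` is in the Landau gauge, `u₁u′ = u₂` satisfies (1.29); so does `1`
  have hq : mgauge U₀ (u₁⁻¹ * u₂)⁻¹ U₁ = U₂ := mgauge_quotient_eq U₀ u₁ u₂ U₁ U₂ U' h₁ h₂
  have hLan' : Lan (mgauge U₀ (u₁⁻¹ * u₂)⁻¹ U₁) := by rw [hq]; exact hLan₂
  have h129' : Restr129 L k Λ U₀ (u₁ * (u₁⁻¹ * u₂)) := by rw [mul_inv_cancel_left]; exact h129₂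
  have hLan1 : Lan (mgauge U₀ (1 : Site d → 𝔸ˣ)⁻¹ U₁) := by rw [inv_one, mgauge_one_gt]; exact hLan₁
  have h1291 : Restr129 L k Λ U₀ (u₁ * 1) := by rw [mul_one]; exact h129₁
  have huniq := hP5u (u₁⁻¹ * u₂) 1 lam (fun _ => 0) hdom hdom1 hLan' h129' hLan1 h1291
  intro j hjk y hy x hx
  have h := huniq j hjk y hy x hx
  rw [Pi.mul_apply, Pi.inv_apply, Pi.one_apply, inv_mul_eq_one] at h
  exact h

end LocalForm

end Literature.MathematicalPhysics.QuantumFieldTheory.Balaban1983to89.B8Thm4UniqueLocal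

end
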